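import Literature.IUT.LogVolume.WildCubicUnitLog
import Literature.IUT.LogVolume.TensorPacketShell
import Literature.IUT.LogVolume.TensorPacketLemmas
import HarnessLib

/-!
# At a wildly ramified pair the Dupuy–Hilado log-shell does NOT contain the normalised packet `(R_I)^∼`

[IUTchIV] (Mochizuki, *Inter-universal Teichmüller theory IV*, RIMS ms Apr. 2020) Prop. 1.1 p. 9 introduces,
for a tensor packet `V = ⊗_{ℚ_p} k_i`, the integral structure `R_I = ⊗_{ℤ_p} R_i` and its normalisation
`(R_I)^∼`; Prop. 1.2 (ii) p. 10 bounds `(R_I)^∼` by the ENLARGED container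
`p^{−⌈d_I + a_I⌉}·log_p(R_I^×)`.  Dupuy–Hilado (arXiv:2004.13228, §4 intro / §4.7) work instead with the
log-shell lattice `I_{v⃗} = ⊗_i (1/2p)·log(𝒪^×_{v̲_i}) = (2p)^{−|I|}·log_p(R_I^×)` — the tree's `logShell`
(abc-iut-S1/S2, `TensorPacketShell.lean`).  At an odd prime where every factor is absolutely UNRAMIFIED the
two agree: `I_{v⃗} = (R_I)^∼` (`inv_two_p_pow_smul_logPacket_eq_normalizedPacket`,
`TensorPacketUnramifiedShell.lean`, abc-iut-S2).

THIS FILE proves that this fails at WILDLY ramified factors, in the smallest example — the kernel form of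
abc-iut-S1's hand computation (cell abc-iut, STATUS 2026-08-25T23:25:47Z «at the wild pair p = 3,
k₁ = k₂ = ℚ₃(∛3) … (R_I)^∼ ⊄ I_k ⊗ I_k»):

* `norm_lift_prod_le_of_mem_logPacket` / `…_logShell` (any `p`, any packet) — a product `⊗ψ_i` of
  `ℚ_p`-linear functionals with `‖ψ_i‖ ≤ C_i` on `log_p(R_i^×)` is bounded by `∏ C_i` on `log_p(R_I^×)` and by
  `‖(2p)^{−|I|}‖·∏ C_i` on the log-shell;
* **`not_normalizedPacket_subset_logShell`** — for `p = 3`, `I = {0, 1}` and both factors equal to a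
  field `K ⊇ ℚ₃` with `[K : ℚ₃] = 3` containing `π`, `π³ = 3` (i.e. `K ≅ ℚ₃(∛3)`, `e = 3`, `d = 5/3`):
  `(R_I)^∼ ⊄ logShell`.  Witness: the idempotent `e₁ = (3·1⊗1 + π²⊗π + π⊗π²)/9` cutting out the factor
  `K` of `K ⊗_{ℚ₃} K ≅ K × K(ζ₃)` (`e₁² = e₁`, so `e₁ ∈ (R_I)^∼`); the functional `Φ = ψ ⊗ ψ`,
  `ψ(a + bπ + cπ²) = a − b`, has `‖Φ‖ ≤ 9·(1/3)² = 1` on the log-shell (`WildCubicUnitLog`: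
  `ψ(log₃ 𝒪_K^×) ⊆ 3ℤ₃`) but `Φ(e₁) = 1/3`, `‖1/3‖₃ = 3`.

So the inclusion `(R_I)^∼ ⊆ (p*)^{−|I|}·⊗log(𝒪^×)` is NOT available at wild places: any reading of
[IUTchIII] (Ind3) / of the hull containers that places `(R_I)^∼`-multiples inside the bare tensor product of
log-shells needs Mochizuki's enlarged exponent `⌈d_I + a_I⌉` (here `⌈10/3 + 2⌉ = 6 > 2 = |I|`, with
`d_i = 5/3` and `a_i = ⌈e_i/(p−2)⌉/e_i = 1`, abc-iut-S1's `logRadiusA`; rev 2: the first filing printed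
`a_I = 4/3`, the sharp convergence exponent, instead of the printed `a_I = 2` — docstring-only change).  This is a
statement about CONTAINERS only; it takes no side on [IUTchIII] Cor. 3.12 and asserts nothing disputed.
Proof-only file (theorems, no definitions).  [cite: Mochizuki2012, IUTchIV Prop. 1.1 p. 9, Prop. 1.2 (ii) p. 10]
[cite: DupuyHilado2025, §4 (intro)] [cite: NeukirchANT1999, Ch. II (5.5)]
-/

noncomputable section

open Metric Set
open scoped TensorProduct Pointwise

namespace Literature.IUT.LogVolume

/-! ## Product functionals are bounded on `log_p(R_I^×)` and on the log-shell -/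

section General

variable (p : ℕ) [Fact p.Prime] {I : Type} [Fintype I]
variable (k : I → Type) [∀ i, NontriviallyNormedField (k i)] [∀ i, NormedAlgebra ℚ_[p] (k i)]

/-- A product `Φ = ⊗_i ψ_i` of `ℚ_p`-linear functionals with `‖ψ_i(z)‖ ≤ C_i` on `log_p(R_i^×)` satisfies
`‖Φ(t)‖ ≤ ∏ C_i` on `log_p(R_I^×) = ⊗ log_p(R_i^×)` (ultrametric inequality over the generating pure tensors).
[cite: Mochizuki2012, IUTchIV Prop. 1.2 p. 10] -/
theorem norm_lift_prod_le_of_mem_logPacket (ψ : ∀ i, k i →ₗ[ℚ_[p]] ℚ_[p]) (C : I → ℝ)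
    (hC : ∀ i, 0 ≤ C i) (hψ : ∀ i, ∀ z ∈ logUnits (k i), ‖ψ i z‖ ≤ C i) {t : PacketAlgebra p k}
    (ht : t ∈ logPacket p k) :
    ‖PiTensorProduct.lift ((MultilinearMap.mkPiAlgebra ℚ_[p] I ℚ_[p]).compLinearMap ψ) t‖ ≤ ∏ i, C i := by
  induction ht using AddSubgroup.closure_induction with
  | mem x hx =>
    obtain ⟨z, hz, rfl⟩ := hx
    rw [purePacket, PiTensorProduct.lift.tprod, MultilinearMap.compLinearMap_apply,
      MultilinearMap.mkPiAlgebra_apply, norm_prod]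
    exact Finset.prod_le_prod (fun i _ => norm_nonneg _) fun i _ => hψ i (z i) (hz i)
  | zero => rw [map_zero, norm_zero]; exact Finset.prod_nonneg fun i _ => hC i
  | add x y _ _ hx hy =>
    rw [map_add]
    exact (IsUltrametricDist.norm_add_le_max _ _).trans (max_le hx hy)
  | neg x _ hx => rw [map_neg, norm_neg]; exact hx

/-- … hence `‖Φ(t)‖ ≤ ‖(2p)^{−|I|}‖·∏ C_i` on the log-shell `I_{v⃗} = (2p)^{−|I|}·log_p(R_I^×)`.
[cite: DupuyHilado2025, §4 (intro)] -/
theorem norm_lift_prod_le_of_mem_logShell (ψ : ∀ i, k i →ₗ[ℚ_[p]] ℚ_[p]) (C : I → ℝ)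
    (hC : ∀ i, 0 ≤ C i) (hψ : ∀ i, ∀ z ∈ logUnits (k i), ‖ψ i z‖ ≤ C i) {t : PacketAlgebra p k}
    (ht : t ∈ logShell p k) :
    ‖PiTensorProduct.lift ((MultilinearMap.mkPiAlgebra ℚ_[p] I ℚ_[p]).compLinearMap ψ) t‖ ≤
      ‖shellScalar p (I := I)‖ * ∏ i, C i := by
  rw [logShell, Set.mem_smul_set] at ht
  obtain ⟨t', ht', rfl⟩ := ht
  rw [map_smul, norm_smul]
  exact mul_le_mul_of_nonneg_left (norm_lift_prod_le_of_mem_logPacket p k ψ C hC hψ ht')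
    (norm_nonneg _)

end General

/-! ## The wild example: `p = 3`, two factors `K = ℚ₃(π)`, `π³ = 3` -/

section Wild

variable {K : Type} [NontriviallyNormedField K] [NormedAlgebra ℚ_[3] K] {π : K}

/-- The scalar of the two-factor `3`-adic log-shell has absolute value `‖(2·3)^{−2}‖₃ = 9`.
[cite: DupuyHilado2025, §4 (intro)] -/
theorem norm_shellScalar_three_two : ‖shellScalar 3 (I := Fin 2)‖ = 9 := by
  have h2 : ‖(2 : ℚ_[3])‖ = 1 := by
    have h := (Padic.norm_natCast_eq_one_iff (p := 3) (n := 2)).mpr (by norm_num)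
    simpa using h
  rw [shellScalar, norm_inv, norm_pow, norm_mul, h2, Padic.norm_p, one_mul, Fintype.card_fin]
  norm_num

/-- Pure tensors of the two-factor packet: `⊗(x, y)·⊗(x', y') = ⊗(xx', yy')`.
[cite: Mochizuki2012, IUTchIV Prop. 1.1 p. 9] -/
theorem purePacket_pair_mul (x y x' y' : K) :
    purePacket 3 (fun _ : Fin 2 => K) ![x, y] * purePacket 3 (fun _ : Fin 2 => K) ![x', y'] =
      purePacket 3 (fun _ : Fin 2 => K) ![x * x', y * y'] := by
  rw [purePacket_mul]
  congr 1
  funext i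
  fin_cases i <;> simp

/-- `⊗(a•x, b•y) = (ab)·⊗(x, y)` for `ℚ₃`-scalars. [cite: Mochizuki2012, IUTchIV Prop. 1.1 p. 9] -/
theorem purePacket_pair_smul (a b : ℚ_[3]) (x y : K) :
    purePacket 3 (fun _ : Fin 2 => K) ![a • x, b • y] = (a * b) • purePacket 3 (fun _ : Fin 2 => K) ![x, y] := by
  have h : (![a • x, b • y] : Fin 2 → K) = fun i => (![a, b] : Fin 2 → ℚ_[3]) i • (![x, y] : Fin 2 → K) i := by
    funext i
    fin_cases i <;> simp
  rw [h, purePacket_smul, Fin.prod_univ_two]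
  simp

/-- `π⁴ = 3π` as a `ℚ₃`-multiple. [cite: NeukirchANT1999, Ch. II (5.5)] -/
theorem pi_pow_four (hπ : π ^ 3 = 3) : π ^ 2 * π ^ 2 = (3 : ℚ_[3]) • π := by
  rw [Algebra.smul_def, map_ofNat, ← hπ]
  ring

/-- `(π²⊗π)² = 3·(π⊗π²)`. [cite: Mochizuki2012, IUTchIV Prop. 1.1 p. 9] -/
theorem t21_mul_t21 (hπ : π ^ 3 = 3) :
    purePacket 3 (fun _ : Fin 2 => K) ![π ^ 2, π] * purePacket 3 (fun _ : Fin 2 => K) ![π ^ 2, π] =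
      3 * purePacket 3 (fun _ : Fin 2 => K) ![π, π ^ 2] := by
  rw [purePacket_pair_mul, pi_pow_four hπ, show π * π = (1 : ℚ_[3]) • π ^ 2 by rw [one_smul, sq],
    purePacket_pair_smul, mul_one, Algebra.smul_def, map_ofNat]

/-- `(π⊗π²)² = 3·(π²⊗π)`. [cite: Mochizuki2012, IUTchIV Prop. 1.1 p. 9] -/
theorem t12_mul_t12 (hπ : π ^ 3 = 3) :
    purePacket 3 (fun _ : Fin 2 => K) ![π, π ^ 2] * purePacket 3 (fun _ : Fin 2 => K) ![π, π ^ 2] =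
      3 * purePacket 3 (fun _ : Fin 2 => K) ![π ^ 2, π] := by
  rw [purePacket_pair_mul, pi_pow_four hπ, show π * π = (1 : ℚ_[3]) • π ^ 2 by rw [one_smul, sq],
    purePacket_pair_smul, one_mul, Algebra.smul_def, map_ofNat]

/-- `(π²⊗π)·(π⊗π²) = π³⊗π³ = 9`. [cite: Mochizuki2012, IUTchIV Prop. 1.1 p. 9] -/
theorem t21_mul_t12 (hπ : π ^ 3 = 3) :
    purePacket 3 (fun _ : Fin 2 => K) ![π ^ 2, π] * purePacket 3 (fun _ : Fin 2 => K) ![π, π ^ 2] = 9 := by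
  have h3 : π ^ 2 * π = (3 : ℚ_[3]) • (1 : K) := by
    rw [Algebra.smul_def, map_ofNat, mul_one, ← hπ]; ring
  have h3' : π * π ^ 2 = (3 : ℚ_[3]) • (1 : K) := by rw [mul_comm]; exact h3
  have hone : (![(1 : K), 1] : Fin 2 → K) = 1 := by funext i; fin_cases i <;> rfl
  rw [purePacket_pair_mul, h3, h3', purePacket_pair_smul, hone, purePacket_one, Algebra.smul_def,
    mul_one, show (3 : ℚ_[3]) * 3 = 9 by norm_num, map_ofNat]

/-- **The idempotent** `e₁ = (3 + π²⊗π + π⊗π²)/9` of `K ⊗_{ℚ₃} K` (it cuts out the factor `K` of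
`K ⊗ K ≅ K × K(ζ₃)`; `π²⊗π/3 = u`, `π⊗π²/3 = u²` with `u = (π⊗1)⁻¹(1⊗π)`, `u³ = 1`): `e₁² = e₁`.
[cite: Mochizuki2012, IUTchIV Prop. 1.1 p. 9] -/
theorem wildIdempotent_mul_self (hπ : π ^ 3 = 3) :
    (9 : ℚ_[3])⁻¹ • ((3 : PacketAlgebra 3 (fun _ : Fin 2 => K)) + purePacket 3 (fun _ : Fin 2 => K) ![π ^ 2, π]
        + purePacket 3 (fun _ : Fin 2 => K) ![π, π ^ 2]) *
      (9 : ℚ_[3])⁻¹ • ((3 : PacketAlgebra 3 (fun _ : Fin 2 => K)) + purePacket 3 (fun _ : Fin 2 => K) ![π ^ 2, π]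
        + purePacket 3 (fun _ : Fin 2 => K) ![π, π ^ 2]) =
      (9 : ℚ_[3])⁻¹ • ((3 : PacketAlgebra 3 (fun _ : Fin 2 => K)) + purePacket 3 (fun _ : Fin 2 => K) ![π ^ 2, π]
        + purePacket 3 (fun _ : Fin 2 => K) ![π, π ^ 2]) := by
  set T21 := purePacket 3 (fun _ : Fin 2 => K) ![π ^ 2, π]
  set T12 := purePacket 3 (fun _ : Fin 2 => K) ![π, π ^ 2]
  have hW : (3 + T21 + T12) * (3 + T21 + T12) = 9 * (3 + T21 + T12) := by
    linear_combination t21_mul_t21 hπ + t12_mul_t12 hπ + 2 * t21_mul_t12 hπ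
  have h9 : (9 : PacketAlgebra 3 (fun _ : Fin 2 => K)) * (3 + T21 + T12) = (9 : ℚ_[3]) • (3 + T21 + T12) := by
    rw [Algebra.smul_def, map_ofNat]
  rw [smul_mul_smul_comm, hW, h9, smul_smul, mul_assoc, inv_mul_cancel₀ (by norm_num : (9 : ℚ_[3]) ≠ 0),
    mul_one]

/-- `e₁ ∈ (R_I)^∼`: an idempotent is integral (root of `X² − X`). [cite: Mochizuki2012, IUTchIV Prop. 1.1 p. 9] -/
theorem wildIdempotent_mem_normalizedPacket (hπ : π ^ 3 = 3) :
    (9 : ℚ_[3])⁻¹ • ((3 : PacketAlgebra 3 (fun _ : Fin 2 => K)) + purePacket 3 (fun _ : Fin 2 => K) ![π ^ 2, π]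
        + purePacket 3 (fun _ : Fin 2 => K) ![π, π ^ 2]) ∈ normalizedPacket 3 (fun _ : Fin 2 => K) := by
  rw [mem_normalizedPacket_iff]
  refine ⟨Polynomial.X * (Polynomial.X - Polynomial.C 1),
    Polynomial.monic_X.mul (Polynomial.monic_X_sub_C 1), ?_⟩
  rw [Polynomial.eval₂_mul, Polynomial.eval₂_sub, Polynomial.eval₂_X, Polynomial.eval₂_C, map_one,
    mul_sub, mul_one, wildIdempotent_mul_self hπ, sub_self]

/-- **The product functional `Φ = ψ ⊗ ψ` takes the value `1/3` at `e₁`** (`ψ(1) = 1`, `ψ(π²)ψ(π) = 0`).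
[cite: Mochizuki2012, IUTchIV Prop. 1.1 p. 9] -/
theorem lift_psi_wildIdempotent (B : Module.Basis (Fin 3) ℚ_[3] K) (hB0 : B 0 = 1)
    (hB1 : B 1 = π) (hB2 : B 2 = π ^ 2) :
    PiTensorProduct.lift ((MultilinearMap.mkPiAlgebra ℚ_[3] (Fin 2) ℚ_[3]).compLinearMap
        (fun _ : Fin 2 => B.coord 0 - B.coord 1))
      ((9 : ℚ_[3])⁻¹ • ((3 : PacketAlgebra 3 (fun _ : Fin 2 => K)) + purePacket 3 (fun _ : Fin 2 => K) ![π ^ 2, π]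
        + purePacket 3 (fun _ : Fin 2 => K) ![π, π ^ 2])) = 3⁻¹ := by
  have hΦ : ∀ x y : K, PiTensorProduct.lift ((MultilinearMap.mkPiAlgebra ℚ_[3] (Fin 2) ℚ_[3]).compLinearMap
      (fun _ : Fin 2 => B.coord 0 - B.coord 1)) (purePacket 3 (fun _ : Fin 2 => K) ![x, y]) =
      (B.coord 0 - B.coord 1) x * (B.coord 0 - B.coord 1) y := by
    intro x y
    rw [purePacket, PiTensorProduct.lift.tprod, MultilinearMap.compLinearMap_apply,
      MultilinearMap.mkPiAlgebra_apply, Fin.prod_univ_two]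
    simp
  have h3 : (3 : PacketAlgebra 3 (fun _ : Fin 2 => K)) = (3 : ℚ_[3]) • purePacket 3 (fun _ : Fin 2 => K) ![1, 1] := by
    have hone : (![(1 : K), 1] : Fin 2 → K) = 1 := by funext i; fin_cases i <;> rfl
    rw [hone, purePacket_one, Algebra.smul_def, mul_one, map_ofNat]
  rw [map_smul, map_add, map_add, h3, map_smul, hΦ, hΦ, hΦ, WildCubic.psi_one B hB0,
    WildCubic.psi_pi B hB1, WildCubic.psi_pi_sq B hB2]
  norm_num

/-- **WILD-SHELL OBSTRUCTION (basis form).** For `K ⊇ ℚ₃` with `ℚ₃`-basis `(1, π, π²)`, `π³ = 3`, the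
normalised two-factor packet is NOT inside the Dupuy–Hilado log-shell:
`(R_I)^∼ ⊄ (2·3)^{−2}·(log₃𝒪_K^× ⊗ log₃𝒪_K^×)`.  [cite: Mochizuki2012, IUTchIV Prop. 1.2 (ii) p. 10]
[cite: DupuyHilado2025, §4 (intro)] -/
theorem not_normalizedPacket_subset_logShell_of_basis [IsUltrametricDist K] [ProperSpace K]
    (hπ : π ^ 3 = 3) (B : Module.Basis (Fin 3) ℚ_[3] K) (hB0 : B 0 = 1) (hB1 : B 1 = π)
    (hB2 : B 2 = π ^ 2) :
    ¬ ((normalizedPacket 3 (fun _ : Fin 2 => K) : Set (PacketAlgebra 3 (fun _ : Fin 2 => K))) ⊆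
        logShell 3 (fun _ : Fin 2 => K)) := by
  intro hsub
  have hmem := hsub (wildIdempotent_mem_normalizedPacket hπ)
  have hle := norm_lift_prod_le_of_mem_logShell 3 (fun _ : Fin 2 => K)
    (fun _ : Fin 2 => B.coord 0 - B.coord 1) (fun _ => 3⁻¹) (fun _ => by norm_num)
    (fun _ z hz => WildCubic.norm_psi_le_of_mem_logUnits B hπ hB0 hB1 hB2 hz) hmem
  have h3 : ‖(3 : ℚ_[3])‖ = 3⁻¹ := by simpa using Padic.norm_p (p := 3)
  rw [lift_psi_wildIdempotent B hB0 hB1 hB2, norm_shellScalar_three_two, Fin.prod_univ_two, norm_inv,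
    h3] at hle
  norm_num at hle

/-- **… whereas `R_I ⊆ logShell` there** (`36·(x⊗y) = (6x)⊗(6y)` and `6x = 3x + 3x ∈ log₃(𝒪_K^×)` by
[IUTchIV] Prop. 1.2 (i)): at the wild pair it is exactly the NORMALISATION that escapes the log-shell.
[cite: Mochizuki2012, IUTchIV Prop. 1.2 (i) p. 10] [cite: DupuyHilado2025, §4 (intro)] -/
theorem integerPacket_subset_logShell_of_basis [IsUltrametricDist K] [ProperSpace K] (hπ : π ^ 3 = 3)
    (B : Module.Basis (Fin 3) ℚ_[3] K) (hB0 : B 0 = 1) (hB1 : B 1 = π) (hB2 : B 2 = π ^ 2) :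
    (integerPacket 3 (fun _ : Fin 2 => K) : Set (PacketAlgebra 3 (fun _ : Fin 2 => K))) ⊆
      logShell 3 (fun _ : Fin 2 => K) := by
  intro t ht
  have hs : (shellScalar 3 (I := Fin 2))⁻¹ = 36 := by
    rw [shellScalar, inv_inv, Fintype.card_fin]; norm_num
  rw [logShell, Set.mem_smul_set_iff_inv_smul_mem₀ (shellScalar_ne_zero 3), hs, SetLike.mem_coe]
  refine integerPacket_induction 3 (fun _ : Fin 2 => K)
    (C := fun t => (36 : ℚ_[3]) • t ∈ logPacket 3 (fun _ : Fin 2 => K)) ?_ ?_ ?_ ?_ ht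
  · intro x hx
    have h6 : ∀ i, (6 : ℚ_[3]) • x i ∈ logUnits K := by
      intro i
      have h3 : 3 * x i ∈ logUnitsAddSubgroup 3 K :=
        WildCubic.three_mul_mem_logUnits B hπ hB0 hB1 hB2 (hx i)
      have e : (6 : ℚ_[3]) • x i = 3 * x i + 3 * x i := by rw [Algebra.smul_def, map_ofNat]; ring
      rw [e]
      exact (logUnitsAddSubgroup 3 K).add_mem h3 h3
    have e : (36 : ℚ_[3]) • purePacket 3 (fun _ : Fin 2 => K) x =
        purePacket 3 (fun _ : Fin 2 => K) (fun i => (6 : ℚ_[3]) • x i) := by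
      rw [purePacket_smul, Fin.prod_univ_two]; norm_num
    rw [e]
    exact AddSubgroup.subset_closure ⟨fun i => (6 : ℚ_[3]) • x i, h6, rfl⟩
  · rw [smul_zero]; exact zero_mem _
  · intro a b ha hb
    rw [smul_add]; exact add_mem ha hb
  · intro a ha
    rw [smul_neg]; exact neg_mem ha

/-! ## The statements over `[K : ℚ₃] = 3` (the basis `(1, π, π²)` built from linear independence) -/

/-- **WILD-SHELL OBSTRUCTION.** Let `K ⊇ ℚ₃` be a field with `[K : ℚ₃] = 3` containing `π` with `π³ = 3`
(`K ≅ ℚ₃(∛3)`, wildly ramified, different exponent `5/3`), and consider the two-factor packet `K ⊗_{ℚ₃} K`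
(`p = 3`, `|I| = 2`).  Then `R_I ⊆ I_{v⃗}` but `(R_I)^∼ ⊄ I_{v⃗} = (2p)^{−|I|}·log_p(R_I^×)`: the
Dupuy–Hilado log-shell lattice does not contain the integral structure `(R_I)^∼` of [IUTchIV] Prop. 1.1;
Mochizuki's container for `(R_I)^∼` is the larger `p^{−⌈d_I + a_I⌉}·log_p(R_I^×)` (Prop. 1.2 (ii); here
`⌈d_I + a_I⌉ = ⌈10/3 + 2⌉ = 6`).  Kernel form of abc-iut-S1's computation; no side taken on Cor. 3.12.
[cite: Mochizuki2012, IUTchIV Prop. 1.2 (ii) p. 10] [cite: DupuyHilado2025, §4 (intro)] -/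
theorem not_normalizedPacket_subset_logShell [IsUltrametricDist K] [ProperSpace K]
    (hK : Module.finrank ℚ_[3] K = 3) (hπ : π ^ 3 = 3) :
    (integerPacket 3 (fun _ : Fin 2 => K) : Set (PacketAlgebra 3 (fun _ : Fin 2 => K))) ⊆
        logShell 3 (fun _ : Fin 2 => K) ∧
      ¬ ((normalizedPacket 3 (fun _ : Fin 2 => K) : Set (PacketAlgebra 3 (fun _ : Fin 2 => K))) ⊆
          logShell 3 (fun _ : Fin 2 => K)) := by
  have hli := WildCubic.linearIndependent_one_pi_pi_sq hπ
  let B := basisOfLinearIndependentOfCardEqFinrank hli (by rw [hK, Fintype.card_fin])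
  have hB : ⇑B = ![(1 : K), π, π ^ 2] := coe_basisOfLinearIndependentOfCardEqFinrank _ _
  have hB0 : B 0 = 1 := by rw [hB]; rfl
  have hB1 : B 1 = π := by rw [hB]; rfl
  have hB2 : B 2 = π ^ 2 := by rw [hB]; rfl
  exact ⟨integerPacket_subset_logShell_of_basis hπ B hB0 hB1 hB2,
    not_normalizedPacket_subset_logShell_of_basis hπ B hB0 hB1 hB2⟩

end Wild

end Literature.IUT.LogVolume

end
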